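import Literature.NumberTheory.Irrationality.Hata1993.IrrationalityMeasureCore
import HarnessLib

/-!
# Hata 1993, Remark 2.1 and Lemma 2.1 (Acta Arith. 63 (1993) 335–349) — PROVED

Topic `Literature/NumberTheory/Irrationality/Hata1993` (file 2 of 2; definition, `LiouvilleWith` bridge and
the core argument are in `IrrationalityMeasureCore.lean`).  Read on the page from M. Hata, *Rational
approximations to π and some other numbers*, Acta Arith. **63** (1993) [Hata1993Pi]
(`paper:doi-10-4064-aa-63-4-335-349`, pp. 337–339, 345).

* p. 339, **Remark 2.1**: "By the same argument as above, one can show that if `qₙγ − pₙ = εₙ` for some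
  irrational number `γ`, `lim_{n→∞} (1/n) log|qₙ| = σ` and `limsup_{n→∞} (1/n) log|εₙ| ≤ −τ`, then `γ`
  has an irrationality measure `1 + σ/τ`.  This slightly improves Proposition 3.3 in [10], in which the
  author posed the unnecessary hypothesis that `γ` is not a Liouville number."  (`σ, τ > 0`, `pₙ, qₙ ∈ ℤ`
  as in Lemma 2.1.)  — `remark_2_1`.  NO non-proportionality / non-vanishing hypothesis: irrationality of
  `γ` and the EXISTENCE of `lim (1/n) log|qₙ|` replace it.
* pp. 337–338, **Lemma 2.1** (case `m = 0`, i.e. `pₙ, qₙ, rₙ ∈ ℤ`): approximations `qₙγ₁ − pₙ = εₙ`,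
  `qₙγ₂ − rₙ = δₙ` with `lim (1/n) log|qₙ| = σ`, `lim (1/n) log|εₙ| = −τ`, `lim (1/n) log|δₙ| = −τ' ≤ −τ`
  and "infinitely many `n`'s satisfying `δₙ/εₙ ≠ ϱ` for any rational number `ϱ`" give: "for any `ε > 0`,
  there exists a positive integer `H₀(ε)` such that `|p + qγ₁ + rγ₂| ≥ H^{−σ/τ−ε}` for any integers
  `p, q, r` with `H ≡ max{|q|, |r|} ≥ H₀(ε)`", hence `1, γ₁, γ₂` are linearly independent over `ℚ`
  — `lemma_2_1`, `lemma_2_1_independent`.  TODO(general form): `pₙ, qₙ, rₙ ∈ ℤ + i√m ℤ` (`m ≥ 0`).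

How the limits are typed.  Lean's `Real.log 0 = 0` and the conditionally complete `limsup` make the literal
renderings fragile, so the hypotheses are stated in the unfolded `ε–N` form the printed proof uses (p. 338:
"there exists an integer `n(ε) ≥ n₀` such that `e^{(σ−δ)n} ≤ |qₙ| ≤ e^{(σ+δ)n}` and
`max{|εₙ|,|δₙ|} ≤ e^{−(τ−δ)n}` for all `n ≥ n(ε)`"): `∀ δ > 0, ∀ᶠ n, e^{(σ−δ)n} ≤ |qₙ| ≤ e^{(σ+δ)n}`
(⇔ `lim (1/n) log|qₙ| = σ`, see `rates_of_tendsto_log`) and `∀ δ > 0, ∀ᶠ n, |εₙ| ≤ e^{−(τ−δ)n}`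
(⇔ `limsup (1/n) log|εₙ| ≤ −τ` for non-zero `εₙ`).  In Lemma 2.1 the printed `lim = −τ`, `lim = −τ'`
imply these bounds AND `εₙ ≠ 0` for large `n` (p. 338 "Obviously there exists an integer `n₀` such that
`qₙ ≠ 0`, `εₙ ≠ 0` and `δₙ ≠ 0` for all `n ≥ n₀`"), which is kept as the hypothesis `hε0`; the
non-proportionality hypothesis is typed in the reading fixed by the printed proof ("`δₙ/εₙ = −q/r` for all
`n ≥ n₁`, contrary to the hypothesis") and by its use on p. 345 ("clearly satisfied since `τ' > τ`"):
for every rational `ϱ`, `δₙ ≠ ϱεₙ` for infinitely many `n`.  So the typed lemma is implied by the printed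
one word for word, and proved here.

Cell pub-zeta5 (HONEST FRAMING: systematic search; no irrationality claim unless certified).
-/

noncomputable section

open Filter Real

namespace Literature.NumberTheory.Irrationality.Hata1993

/-- **Hata 1993, Remark 2.1** (PROVED): if `qₙγ − pₙ = εₙ` for an irrational `γ` and integers `pₙ, qₙ` with
`lim (1/n) log|qₙ| = σ > 0` and `limsup (1/n) log|εₙ| ≤ −τ`, `τ > 0` (both typed in the unfolded `ε–N` form
of the printed proof, module docstring), then `γ` has an irrationality measure `1 + σ/τ` — with NO
non-vanishing or non-proportionality hypothesis on the approximations. [cite: Hata1993Pi, Remark 2.1 (p. 339)] -/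
theorem remark_2_1 {γ σ τ : ℝ} (hγ : Irrational γ) (hσ : 0 < σ) (hτ : 0 < τ) (p q : ℕ → ℤ)
    (hq : ∀ δ : ℝ, 0 < δ → ∀ᶠ n : ℕ in atTop,
      Real.exp ((σ - δ) * n) ≤ |(q n : ℝ)| ∧ |(q n : ℝ)| ≤ Real.exp ((σ + δ) * n))
    (herr : ∀ δ : ℝ, 0 < δ → ∀ᶠ n : ℕ in atTop, |(q n : ℝ) * γ - p n| ≤ Real.exp (-((τ - δ) * n))) :
    HasIrrationalityMeasure γ (1 + σ / τ) := by
  intro ε hε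
  -- δ = δ(ε) with (σ+δ)/(τ-3δ) ≤ σ/τ + ε/2 =: κ and δ ≤ τ/7 (p. 338)
  set κ := σ / τ + ε / 2 with hκ_def
  obtain ⟨δ, hδpos, hδτ, hδslope⟩ := exists_delta hσ hτ hε
  set a := σ + δ with ha_def
  set b := σ - δ with hb_def
  set t := τ - δ with ht_def
  have ha : 0 < a := by positivity
  have ht : 0 < t := by rw [ht_def]; linarith
  have hs : a < b + t := by rw [ha_def, hb_def, ht_def]; linarith
  have hsa : 0 < b + t - a := by linarith
  -- slope bound: a/(b+t-a) = (σ+δ)/(τ-3δ) ≤ κ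
  have hslope : a / (b + t - a) ≤ κ := by
    have : b + t - a = τ - 3 * δ := by rw [ha_def, hb_def, ht_def]; ring
    rw [this, ha_def]; exact hδslope
  -- N₀ from the rate hypotheses at this δ
  obtain ⟨N₀, hN₀⟩ := eventually_atTop.1 ((hq δ hδpos).and (herr δ hδpos))
  -- the constant K and the threshold q₀
  set K := coreConst a b t with hK_def
  have hK0 : 0 ≤ K := coreConst_nonneg ha ht
  obtain ⟨q₀, hq₀⟩ := exists_nat_gt (max (Real.exp (t * (N₀ + 1))) (Real.exp (2 * K / ε)))
  have hq₀exp1 : Real.exp (t * (N₀ + 1)) < q₀ := lt_of_le_of_lt (le_max_left _ _) hq₀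
  have hq₀exp2 : Real.exp (2 * K / ε) < q₀ := lt_of_le_of_lt (le_max_right _ _) hq₀
  have hq₀pos : 0 < q₀ := by
    have : (0 : ℝ) < q₀ := lt_trans (Real.exp_pos _) hq₀exp1
    exact_mod_cast this
  refine ⟨q₀, hq₀pos, fun p' q' hq' => ?_⟩
  -- H = q' ≥ q₀ ≥ 1
  have hH1 : (q₀ : ℝ) ≤ (q' : ℝ) := by exact_mod_cast hq'
  have hHpos : (0 : ℝ) < q' := lt_of_lt_of_le (by exact_mod_cast hq₀pos) hH1
  have hHge1 : (1 : ℝ) ≤ q' := by exact_mod_cast (show (1 : ℤ) ≤ q' by omega)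
  -- Λ = q'γ - p' ≠ 0
  set Λ := (q' : ℝ) * γ - p' with hΛ_def
  have hq'ne : q' ≠ 0 := by
    rintro rfl; simp at hHpos
  have hΛ : Λ ≠ 0 := by
    intro h0
    have : γ = (p' : ℝ) / q' := by
      rw [eq_div_iff hHpos.ne']
      rw [hΛ_def] at h0; linarith
    exact (irrational_iff_ne_rational γ).1 hγ p' q' hq'ne this
  have hΛpos : 0 < |Λ| := abs_pos.2 hΛ
  -- Aₙ = q' pₙ - p' qₙ, ωₙ = q' εₙ
  set A : ℕ → ℤ := fun n => q' * p n - p' * q n with hA_def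
  set ω : ℕ → ℝ := fun n => (q' : ℝ) * ((q n : ℝ) * γ - p n) with hω_def
  have hid : ∀ n, N₀ ≤ n → (q n : ℝ) * Λ = A n + ω n := by
    intro n _
    show (q n : ℝ) * ((q' : ℝ) * γ - p') =
      ((q' * p n - p' * q n : ℤ) : ℝ) + (q' : ℝ) * ((q n : ℝ) * γ - p n)
    push_cast; ring
  have hqb : ∀ n, N₀ ≤ n → Real.exp (b * n) ≤ |(q n : ℝ)| ∧ |(q n : ℝ)| ≤ Real.exp (a * n) :=
    fun n hn => (hN₀ n hn).1
  have hωb : ∀ n, N₀ ≤ n → |ω n| ≤ (q' : ℝ) * Real.exp (-(t * n)) := by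
    intro n hn
    have h := (hN₀ n hn).2
    simp only [hω_def, abs_mul, abs_of_pos hHpos]
    exact mul_le_mul_of_nonneg_left h hHpos.le
  have hΩ : ∀ n₁ : ℕ, ∃ n, n₁ ≤ n ∧ A n ≠ 0 :=
    exists_ne_zero_of_ne_zero hΛ hHpos (by linarith) (fun n hn => (hqb n hn).1) hωb hid
  have hthr : Real.exp (t * (N₀ + 1)) ≤ 4 * (q' : ℝ) := by linarith
  have hba : b ≤ a := by rw [ha_def, hb_def]; linarith
  have core := log_lower_bound_core hΛ hHge1 ha ht hs hba hqb hωb hid hΩ hthr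
  -- log|Λ| ≥ -K - κ log H, and log H ≥ 2K/ε
  have hlogH : 0 ≤ Real.log (q' : ℝ) := Real.log_nonneg hHge1
  have hlogHK : 2 * K / ε ≤ Real.log (q' : ℝ) := by
    have := Real.log_le_log (Real.exp_pos _) (hq₀exp2.le.trans hH1)
    rwa [Real.log_exp] at this
  have h1 : -K - κ * Real.log (q' : ℝ) ≤ Real.log |Λ| := by
    have : a / (b + t - a) * Real.log (q' : ℝ) ≤ κ * Real.log (q' : ℝ) :=
      mul_le_mul_of_nonneg_right hslope hlogH
    linarith
  -- |γ - p'/q'| = |Λ| / H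
  have hdiff : |γ - (p' : ℝ) / q'| = |Λ| / q' := by
    have : γ - (p' : ℝ) / q' = Λ / q' := by
      rw [hΛ_def, eq_div_iff hHpos.ne', sub_mul, div_mul_cancel₀ _ hHpos.ne']; ring
    rw [this, abs_div, abs_of_pos hHpos]
  have hdiffpos : 0 < |γ - (p' : ℝ) / q'| := by rw [hdiff]; positivity
  -- log of the target: -(1 + σ/τ + ε) log H ≤ log|Λ| - log H
  have h2 : -(1 + σ / τ + ε) * Real.log (q' : ℝ) ≤ Real.log |Λ| - Real.log (q' : ℝ) := by
    have hKε : K ≤ ε / 2 * Real.log (q' : ℝ) := by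
      have := mul_le_mul_of_nonneg_left hlogHK (show (0 : ℝ) ≤ ε / 2 by linarith)
      rw [show ε / 2 * (2 * K / ε) = K by field_simp] at this
      exact this
    rw [hκ_def] at h1
    nlinarith
  -- exponentiate
  rw [Real.rpow_def_of_pos hHpos, hdiff]
  have h3 : Real.log (q' : ℝ) * -(1 + σ / τ + ε) ≤ Real.log (|Λ| / q') := by
    rw [Real.log_div hΛpos.ne' hHpos.ne']; linarith
  calc Real.exp (Real.log (q' : ℝ) * -(1 + σ / τ + ε))
      ≤ Real.exp (Real.log (|Λ| / q')) := Real.exp_le_exp.2 h3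
    _ = |Λ| / q' := Real.exp_log (by positivity)

/-- The hypothesis of `remark_2_1` on `qₙ` from the literal limit `lim (1/n) log|qₙ| = σ` (`σ > 0`;
Lean's `Real.log 0 = 0` makes `qₙ ≠ 0` automatic eventually). [cite: Hata1993Pi, Remark 2.1 (p. 339)] -/
theorem rates_of_tendsto_log {σ : ℝ} (hσ : 0 < σ) {q : ℕ → ℤ}
    (h : Tendsto (fun n : ℕ => Real.log |(q n : ℝ)| / n) atTop (nhds σ)) :
    ∀ δ : ℝ, 0 < δ → ∀ᶠ n : ℕ in atTop,
      Real.exp ((σ - δ) * n) ≤ |(q n : ℝ)| ∧ |(q n : ℝ)| ≤ Real.exp ((σ + δ) * n) := by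
  intro δ hδ
  set δ' := min δ (σ / 2) with hδ'
  have hδ'pos : 0 < δ' := lt_min hδ (by linarith)
  have hδ'le : δ' ≤ δ := min_le_left _ _
  have hδ'σ : δ' < σ := lt_of_le_of_lt (min_le_right _ _) (by linarith)
  have hev := (Metric.tendsto_atTop.1 h) δ' hδ'pos
  obtain ⟨N, hN⟩ := hev
  filter_upwards [eventually_ge_atTop (max N 1)] with n hn
  have hnN : N ≤ n := le_trans (le_max_left _ _) hn
  have hn1 : (1 : ℝ) ≤ n := by exact_mod_cast le_trans (le_max_right _ _) hn
  have hn0 : (0 : ℝ) < n := by linarith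
  have hd := hN n hnN
  rw [Real.dist_eq, abs_lt] at hd
  obtain ⟨hd1, hd2⟩ := hd
  -- q n ≠ 0: otherwise log|q n|/n = 0, |0 - σ| < δ' ≤ σ/2 impossible
  have hqne : (q n : ℝ) ≠ 0 := by
    intro h0
    rw [h0, abs_zero, Real.log_zero, zero_div] at hd1
    linarith
  have hqpos : 0 < |(q n : ℝ)| := abs_pos.2 hqne
  have hlo : (σ - δ') * n < Real.log |(q n : ℝ)| := by
    have h' : σ - δ' < Real.log |(q n : ℝ)| / n := by linarith
    rwa [lt_div_iff₀ hn0] at h'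
  have hhi : Real.log |(q n : ℝ)| < (σ + δ') * n := by
    have h' : Real.log |(q n : ℝ)| / n < σ + δ' := by linarith
    rwa [div_lt_iff₀ hn0] at h'
  constructor
  · calc Real.exp ((σ - δ) * n) ≤ Real.exp ((σ - δ') * n) :=
          Real.exp_le_exp.2 (mul_le_mul_of_nonneg_right (by linarith) hn0.le)
      _ ≤ Real.exp (Real.log |(q n : ℝ)|) := Real.exp_le_exp.2 hlo.le
      _ = |(q n : ℝ)| := Real.exp_log hqpos
  · calc |(q n : ℝ)| = Real.exp (Real.log |(q n : ℝ)|) := (Real.exp_log hqpos).symm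
      _ ≤ Real.exp ((σ + δ') * n) := Real.exp_le_exp.2 hhi.le
      _ ≤ Real.exp ((σ + δ) * n) :=
          Real.exp_le_exp.2 (mul_le_mul_of_nonneg_right (by linarith) hn0.le)
/-! ### Lemma 2.1 (two numbers; case `m = 0`) -/

/-- **Hata 1993, Lemma 2.1** (case `m = 0`, PROVED): rational approximations `qₙγ₁ − pₙ = εₙ`,
`qₙγ₂ − rₙ = δₙ` with `lim (1/n) log|qₙ| = σ > 0` and error rates `≤ −τ < 0` (typed, as the printed proof
uses them, by the eventual bounds `e^{(σ−δ)n} ≤ |qₙ| ≤ e^{(σ+δ)n}`, `max{|εₙ|,|δₙ|} ≤ e^{−(τ−δ)n}` for every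
`δ > 0`; the printed `lim (1/n) log|δₙ| = −τ' ≤ −τ` implies the bound for `δₙ`), `εₙ ≠ 0` for all large `n`
(p. 338: "Obviously there exists an integer `n₀` such that `qₙ ≠ 0`, `εₙ ≠ 0` and `δₙ ≠ 0` for all
`n ≥ n₀`" — a consequence of the printed limit hypotheses), and the non-proportionality hypothesis in the
reading fixed by the printed proof ("`δₙ/εₙ = −q/r` for all `n ≥ n₁`, contrary to the hypothesis", p. 338) and
by its application (p. 345: "clearly satisfied since `τ' > τ`"): for every rational `ϱ`, `δₙ ≠ ϱεₙ` for
infinitely many `n`.  Conclusion (p. 338): for every `ε > 0` there is `H₀(ε)` with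
`|p + qγ₁ + rγ₂| ≥ H^{−σ/τ−ε}` for all integers `p, q, r` with `H = max{|q|,|r|} ≥ H₀(ε)`.
[cite: Hata1993Pi, Lemma 2.1 (pp. 337–339)] -/
theorem lemma_2_1 {γ₁ γ₂ σ τ : ℝ} (hσ : 0 < σ) (hτ : 0 < τ) (p q r : ℕ → ℤ)
    (hq : ∀ δ : ℝ, 0 < δ → ∀ᶠ n : ℕ in atTop,
      Real.exp ((σ - δ) * n) ≤ |(q n : ℝ)| ∧ |(q n : ℝ)| ≤ Real.exp ((σ + δ) * n))
    (herr : ∀ δ : ℝ, 0 < δ → ∀ᶠ n : ℕ in atTop,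
      |(q n : ℝ) * γ₁ - p n| ≤ Real.exp (-((τ - δ) * n)) ∧
        |(q n : ℝ) * γ₂ - r n| ≤ Real.exp (-((τ - δ) * n)))
    (hε0 : ∀ᶠ n : ℕ in atTop, (q n : ℝ) * γ₁ - p n ≠ 0)
    (hind : ∀ ϱ : ℚ, ∃ᶠ n : ℕ in atTop,
      (q n : ℝ) * γ₂ - r n ≠ (ϱ : ℝ) * ((q n : ℝ) * γ₁ - p n)) :
    ∀ ε : ℝ, 0 < ε → ∃ H₀ : ℕ, 0 < H₀ ∧ ∀ p' q' r' : ℤ, (H₀ : ℤ) ≤ max |q'| |r'| →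
      ((max |q'| |r'| : ℤ) : ℝ) ^ (-(σ / τ + ε)) ≤ |(p' : ℝ) + q' * γ₁ + r' * γ₂| := by
  intro ε hε
  set κ := σ / τ + ε / 2 with hκ_def
  have hκpos : 0 < κ := by positivity
  obtain ⟨δ, hδpos, hδτ, hδslope⟩ := exists_delta hσ hτ hε
  set a := σ + δ with ha_def
  set b := σ - δ with hb_def
  set t := τ - δ with ht_def
  have ha : 0 < a := by positivity
  have ht : 0 < t := by rw [ht_def]; linarith
  have hs : a < b + t := by rw [ha_def, hb_def, ht_def]; linarith
  have hsa : 0 < b + t - a := by linarith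
  have hba : b ≤ a := by rw [ha_def, hb_def]; linarith
  have hslope : a / (b + t - a) ≤ κ := by
    have : b + t - a = τ - 3 * δ := by rw [ha_def, hb_def, ht_def]; ring
    rw [this, ha_def]; exact hδslope
  obtain ⟨N₀, hN₀⟩ := eventually_atTop.1 (((hq δ hδpos).and (herr δ hδpos)).and hε0)
  set K := coreConst a b t with hK_def
  have hK0 : 0 ≤ K := coreConst_nonneg ha ht
  have hlog2 : 0 ≤ Real.log 2 := Real.log_nonneg (by norm_num)
  set K' := K + κ * Real.log 2 with hK'_def
  have hK'0 : 0 ≤ K' := by positivity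
  obtain ⟨H₀, hH₀⟩ := exists_nat_gt (max (Real.exp (t * (N₀ + 1))) (Real.exp (2 * K' / ε)))
  have hH₀exp1 : Real.exp (t * (N₀ + 1)) < H₀ := lt_of_le_of_lt (le_max_left _ _) hH₀
  have hH₀exp2 : Real.exp (2 * K' / ε) < H₀ := lt_of_le_of_lt (le_max_right _ _) hH₀
  have hH₀pos : 0 < H₀ := by
    have : (0 : ℝ) < H₀ := lt_trans (Real.exp_pos _) hH₀exp1
    exact_mod_cast this
  refine ⟨H₀, hH₀pos, fun p' q' r' hH' => ?_⟩
  -- H = max |q'| |r'|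
  set Hz : ℤ := max |q'| |r'| with hHz_def
  have hHzR : ((Hz : ℤ) : ℝ) = max |(q' : ℝ)| |(r' : ℝ)| := by rw [hHz_def]; push_cast; rfl
  set H : ℝ := ((Hz : ℤ) : ℝ) with hH_def
  have hH1 : (H₀ : ℝ) ≤ H := by rw [hH_def]; exact_mod_cast hH'
  have hHpos : 0 < H := lt_of_lt_of_le (by exact_mod_cast hH₀pos) hH1
  have hHge1 : (1 : ℝ) ≤ H := by rw [hH_def]; exact_mod_cast (show (1 : ℤ) ≤ Hz by omega)
  have hq'H : |(q' : ℝ)| ≤ H := by rw [hHzR]; exact le_max_left _ _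
  have hr'H : |(r' : ℝ)| ≤ H := by rw [hHzR]; exact le_max_right _ _
  -- Λ, Aₙ, ωₙ
  set Λ := (p' : ℝ) + q' * γ₁ + r' * γ₂ with hΛ_def
  set A : ℕ → ℤ := fun n => p' * q n + q' * p n + r' * r n with hA_def
  set ω : ℕ → ℝ := fun n => (q' : ℝ) * ((q n : ℝ) * γ₁ - p n) + (r' : ℝ) * ((q n : ℝ) * γ₂ - r n)
    with hω_def
  have hid : ∀ n, N₀ ≤ n → (q n : ℝ) * Λ = A n + ω n := by
    intro n _
    show (q n : ℝ) * ((p' : ℝ) + q' * γ₁ + r' * γ₂) = ((p' * q n + q' * p n + r' * r n : ℤ) : ℝ) +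
      ((q' : ℝ) * ((q n : ℝ) * γ₁ - p n) + (r' : ℝ) * ((q n : ℝ) * γ₂ - r n))
    push_cast; ring
  have hqb : ∀ n, N₀ ≤ n → Real.exp (b * n) ≤ |(q n : ℝ)| ∧ |(q n : ℝ)| ≤ Real.exp (a * n) :=
    fun n hn => (hN₀ n hn).1.1
  have hωb : ∀ n, N₀ ≤ n → |ω n| ≤ 2 * H * Real.exp (-(t * n)) := by
    intro n hn
    obtain ⟨h1, h2⟩ := (hN₀ n hn).1.2
    have e1 : |(q' : ℝ) * ((q n : ℝ) * γ₁ - p n)| ≤ H * Real.exp (-(t * n)) := by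
      rw [abs_mul]; exact mul_le_mul hq'H h1 (abs_nonneg _) hHpos.le
    have e2 : |(r' : ℝ) * ((q n : ℝ) * γ₂ - r n)| ≤ H * Real.exp (-(t * n)) := by
      rw [abs_mul]; exact mul_le_mul hr'H h2 (abs_nonneg _) hHpos.le
    calc |ω n| ≤ |(q' : ℝ) * ((q n : ℝ) * γ₁ - p n)| + |(r' : ℝ) * ((q n : ℝ) * γ₂ - r n)| :=
          abs_add_le _ _
      _ ≤ 2 * H * Real.exp (-(t * n)) := by linarith
  -- ωₙ ≠ 0 for arbitrarily large n (the non-proportionality hypothesis; p. 338)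
  have hωnz : ∀ n₁ : ℕ, ∃ n, n₁ ≤ n ∧ ω n ≠ 0 := by
    intro n₁
    by_contra hcon
    push Not at hcon
    rcases eq_or_ne r' 0 with hr0 | hr0
    · -- r' = 0: then q' ≠ 0 and εₙ = 0 for n ≥ n₁, contradicting hε0
      have hq0 : q' ≠ 0 := by
        intro hq0
        have : Hz = 0 := by rw [hHz_def, hq0, hr0]; simp
        have h1 : (1 : ℤ) ≤ Hz := by omega
        omega
      have hn := hcon (max n₁ N₀) (le_max_left _ _)
      have hεne := (hN₀ (max n₁ N₀) (le_max_right _ _)).2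
      simp only [hω_def, hr0, Int.cast_zero, zero_mul, add_zero] at hn
      rcases mul_eq_zero.1 hn with h | h
      · exact hq0 (by exact_mod_cast h)
      · exact hεne h
    · -- r' ≠ 0: δₙ = (-q'/r') εₙ for all n ≥ n₁, contradicting hind at ϱ = -q'/r'
      obtain ⟨n, hn1, hne⟩ := Filter.frequently_atTop.1 (hind ((-q' : ℚ) / r')) n₁
      have hn := hcon n hn1
      simp only [hω_def] at hn
      apply hne
      have hr0' : (r' : ℝ) ≠ 0 := by exact_mod_cast hr0
      push_cast
      field_simp
      linarith
  -- Λ ≠ 0 (else Aₙ = −ωₙ is an integer of absolute value < 1, so ωₙ = 0, for all large n)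
  have hΛ : Λ ≠ 0 := by
    intro h0
    obtain ⟨N', hN'⟩ := exists_nat_gt (max (N₀ : ℝ) (Real.log (2 * H) / t))
    have hN'0 : N₀ ≤ N' := by
      have : (N₀ : ℝ) < N' := lt_of_le_of_lt (le_max_left _ _) hN'
      exact_mod_cast this.le
    have hN't : Real.log (2 * H) / t < N' := lt_of_le_of_lt (le_max_right _ _) hN'
    obtain ⟨n, hn, hωn⟩ := hωnz N'
    have hn0 : N₀ ≤ n := le_trans hN'0 hn
    have hidn := hid n hn0
    rw [h0, mul_zero] at hidn
    -- |A n| = |ω n| < 1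
    have hsmall : 2 * H * Real.exp (-(t * n)) < 1 := by
      have h1 : Real.log (2 * H) < t * n := by
        have := (div_lt_iff₀ ht).1 hN't
        have hnn : (N' : ℝ) ≤ n := by exact_mod_cast hn
        nlinarith
      have h2 : 2 * H < Real.exp (t * n) := by
        calc 2 * H = Real.exp (Real.log (2 * H)) := (Real.exp_log (by positivity)).symm
          _ < Real.exp (t * n) := Real.exp_lt_exp.2 h1
      rw [Real.exp_neg, mul_inv_lt_iff₀ (Real.exp_pos _)]; linarith
    have hAabs : |(A n : ℝ)| < 1 := by
      have : (A n : ℝ) = -ω n := by linarith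
      rw [this, abs_neg]; linarith [hωb n hn0]
    have hA0 : A n = 0 := by
      have : |A n| < 1 := by exact_mod_cast (show |(A n : ℝ)| < 1 from hAabs)
      exact Int.abs_lt_one_iff.mp this
    rw [hA0, Int.cast_zero, zero_add] at hidn
    exact hωn hidn.symm
  have hΩ : ∀ n₁ : ℕ, ∃ n, n₁ ≤ n ∧ A n ≠ 0 :=
    exists_ne_zero_of_ne_zero hΛ (by positivity : (0 : ℝ) < 2 * H) (by linarith)
      (fun n hn => (hqb n hn).1) hωb hid
  have hthr : Real.exp (t * (N₀ + 1)) ≤ 4 * (2 * H) := by linarith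
  have hW1 : (1 : ℝ) ≤ 2 * H := by linarith
  have core := log_lower_bound_core hΛ hW1 ha ht hs hba hqb hωb hid hΩ hthr
  -- log|Λ| ≥ -K - κ log(2H) = -K' - κ log H, and log H ≥ 2K'/ε
  have hΛpos : 0 < |Λ| := abs_pos.2 hΛ
  have hlogH : 0 ≤ Real.log H := Real.log_nonneg hHge1
  have hlogHK : 2 * K' / ε ≤ Real.log H := by
    have := Real.log_le_log (Real.exp_pos _) (hH₀exp2.le.trans hH1)
    rwa [Real.log_exp] at this
  have h1 : -K' - κ * Real.log H ≤ Real.log |Λ| := by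
    rw [Real.log_mul (by norm_num) hHpos.ne'] at core
    have e1 : a / (b + t - a) * (Real.log 2 + Real.log H) ≤ κ * (Real.log 2 + Real.log H) :=
      mul_le_mul_of_nonneg_right hslope (by positivity)
    rw [hK'_def]; linarith
  have h2 : -(σ / τ + ε) * Real.log H ≤ Real.log |Λ| := by
    have hKε : K' ≤ ε / 2 * Real.log H := by
      have := mul_le_mul_of_nonneg_left hlogHK (show (0 : ℝ) ≤ ε / 2 by linarith)
      rw [show ε / 2 * (2 * K' / ε) = K' by field_simp] at this
      exact this
    rw [hκ_def] at h1
    linarith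
  rw [Real.rpow_def_of_pos hHpos]
  calc Real.exp (Real.log H * -(σ / τ + ε)) ≤ Real.exp (Real.log |Λ|) :=
        Real.exp_le_exp.2 (by linarith)
    _ = |Λ| := Real.exp_log hΛpos

/-- **Lemma 2.1, first conclusion**: under the same hypotheses `1, γ₁, γ₂` are linearly independent over `ℚ`
(stated over `ℤ`, equivalent after clearing denominators). [cite: Hata1993Pi, Lemma 2.1 (p. 338)] -/
theorem lemma_2_1_independent {γ₁ γ₂ σ τ : ℝ} (hσ : 0 < σ) (hτ : 0 < τ) (p q r : ℕ → ℤ)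
    (hq : ∀ δ : ℝ, 0 < δ → ∀ᶠ n : ℕ in atTop,
      Real.exp ((σ - δ) * n) ≤ |(q n : ℝ)| ∧ |(q n : ℝ)| ≤ Real.exp ((σ + δ) * n))
    (herr : ∀ δ : ℝ, 0 < δ → ∀ᶠ n : ℕ in atTop,
      |(q n : ℝ) * γ₁ - p n| ≤ Real.exp (-((τ - δ) * n)) ∧
        |(q n : ℝ) * γ₂ - r n| ≤ Real.exp (-((τ - δ) * n)))
    (hε0 : ∀ᶠ n : ℕ in atTop, (q n : ℝ) * γ₁ - p n ≠ 0)
    (hind : ∀ ϱ : ℚ, ∃ᶠ n : ℕ in atTop,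
      (q n : ℝ) * γ₂ - r n ≠ (ϱ : ℝ) * ((q n : ℝ) * γ₁ - p n))
    (p' q' r' : ℤ) (hne : (p', q', r') ≠ (0, 0, 0)) :
    (p' : ℝ) + q' * γ₁ + r' * γ₂ ≠ 0 := by
  obtain ⟨H₀, hH₀, hb⟩ := lemma_2_1 hσ hτ p q r hq herr hε0 hind 1 one_pos
  by_cases hqr : q' = 0 ∧ r' = 0
  · obtain ⟨hq0, hr0⟩ := hqr
    have hp0 : p' ≠ 0 := by rintro rfl; exact hne (by rw [hq0, hr0])
    simp only [hq0, hr0, Int.cast_zero, zero_mul, add_zero]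
    exact_mod_cast hp0
  · -- scale by k = H₀
    have hmax : (1 : ℤ) ≤ max |q'| |r'| := by
      rcases not_and_or.1 hqr with h | h
      · exact le_trans (Int.one_le_abs h) (le_max_left _ _)
      · exact le_trans (Int.one_le_abs h) (le_max_right _ _)
    have hk : (H₀ : ℤ) ≤ max |(H₀ : ℤ) * q'| |(H₀ : ℤ) * r'| := by
      rw [abs_mul, abs_mul, Int.abs_natCast, ← mul_max_of_nonneg _ _ (by positivity)]
      nlinarith
    have key := hb ((H₀ : ℤ) * p') ((H₀ : ℤ) * q') ((H₀ : ℤ) * r') hk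
    have hpos : (0 : ℝ) < ((max |(H₀ : ℤ) * q'| |(H₀ : ℤ) * r'| : ℤ) : ℝ) ^ (-(σ / τ + 1)) := by
      apply Real.rpow_pos_of_pos
      exact_mod_cast (lt_of_lt_of_le (by exact_mod_cast hH₀ : (0 : ℤ) < H₀) hk)
    intro h0
    have : ((H₀ : ℤ) : ℝ) * ((p' : ℝ) + q' * γ₁ + r' * γ₂) = 0 := by rw [h0, mul_zero]
    have h' : |(((H₀ : ℤ) * p' : ℤ) : ℝ) + (((H₀ : ℤ) * q' : ℤ) : ℝ) * γ₁ +
        (((H₀ : ℤ) * r' : ℤ) : ℝ) * γ₂| = 0 := by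
      rw [abs_eq_zero]; push_cast; push_cast at this; linarith
    linarith

end Literature.NumberTheory.Irrationality.Hata1993
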